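import Mathlib
import Summits.Ventures.HodgeRepro.Tier4.Line4.StabilityOfProjected
import Summits.Ventures.HodgeRepro.Tier4.Line4.ConjSpanLemmas

/-!
# Tier4/Line4/ConjStability — B-L4-CONJ: the stability clauses `hst₁`, `hst₂` of L1-p5's `W3TwoVector` in their
CONJUGATE shape, discharged for the projected pair at the NEGATED exponents

Blind re-derivation cell `pub-hodge-repro`, Tier 4 «prove the step» (README §9–§10), seat t4-L4-p2 (prover, LINE L4,
gen 3; plan-4's ruling S13991 on crit-2's O-L4-2VEC-BIND-c2 / crit-1's O-L4-PROJ-SHAPE, cut B-L4-CONJ). Tree path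
`lean/Summits/Ventures/HodgeRepro/Tier4/Line4/ConjStability.lean`. Mathlib-level; no literature. Inputs: this seat's
`Line4/StabilityOfProjected` (`projTest`, `rightRegular_cj_projTest_mem`, `rightRegular_refl_projTest_mem`), L4-p1's
`Line4/ConjSpanLemmas` (`coe_span_eq_of_isInvariantSubspace`), typer-2's `Common/KTypeSpace` v0.2 (`kTypeSpace'`).

THE SHAPE.  `W3TwoVector.mixed_two_torus_W3_twoVector` (p687589) asks `hst₁ : ∀ j, conj ∘ R(cj f₁)(φ j) ∈
kTypeSpace' W q g g' eP' eM' K (V (n j))` (and `hst₂` with `refl f₂`), with `V` the CONJUGATE family (the planner's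
instance `V m = span ℂ (conj '' τ m)`, v0.25 example (x)).  `StabilityOfProjected` gives the DIRECT shape
`R(cj (projTest_{e′} f))(φ j) ∈ kTypeSpace'_{e′} K (span ℂ (τ (n j)))`; conjugation negates the weights, so the
discharge is `projTest` at the NEGATED exponents `(−eP′, −eM′)` (its place data carry `conj weightChar'_{−e′} =
weightChar'_{e′}`) followed by the conjugation transport.
* `mem_kTypeSpace'_conj`: `ψ ∈ kTypeSpace'_{−e′} K V` and `conj ∘ ψ ∈ V′` give `conj ∘ ψ ∈ kTypeSpace'_{e′} K V′`
  (`conj (u ^ (−e)) = u ^ e` for `‖u‖ = 1` — the unit modulus of `weightAt'` on the local torus is DISPLAYED as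
  `hnorm`, typer-2's RowWeights on the row planes);
* **`hst₁_projTest_neg`**, **`hst₂_projTest_neg`**: for `f₁ := projTest_{−e′} f`, `f₂ := projTest_{−e′} f'` (any two
  test functions), every adapted ONB `(τ, φ, n)` and every `j`, the clauses `hst₁`, `hst₂` of `W3TwoVector` hold
  VERBATIM with `V m := span ℂ (conj '' τ m)` (and, `hst₁_projTest_neg_of_le`, with any `V m ⊇ conj '' τ m`).
With this module the (b″) row of the residual reads: discharged by name for the natural pair; what stays of the
re-typed wall is the closed adapted ONB (tree), `hadm` for the hit constituents and `hJ : Jc (f₁ ⋆ f₂) ≠ 0` for a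
`projTest_{−e′}` pair (plan-4's C-L4-W5PROJ).

Nothing here says anything about the status of the Hodge conjecture for CM abelian varieties, which is NOT proved
(HC_CM is NOT proved by anyone in this repository).
-/

set_option autoImplicit false

noncomputable section

namespace Summit.Ventures.HodgeRepro.Tier4.Line4

open Summit.Ventures.HodgeRepro.Tier4.Common Summit.Ventures.HodgeRepro.Tier4.Line1 MeasureTheory NumberField
open scoped ComplexConjugate

section ConjTransport

variable {k : Type} [Field k] [NumberField k] (W : PlaneData k) [MeasurableSpace (GA W)]
  (q : QuadData k) (g g' : Matrix (Fin 4) (Fin 4) k) (eP' eM' : InfinitePlace k → ℤ) (K : Subgroup (GA W))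

/-- `conj (u ^ (−e)) = u ^ e` for a unit `u`. -/
theorem conj_zpow_neg_of_norm_one {u : ℂ} (hu : ‖u‖ = 1) (e : ℤ) : conj (u ^ (-e)) = u ^ e := by
  rw [map_zpow₀, conj_eq_inv_of_norm_one hu, inv_zpow', neg_neg]

omit [MeasurableSpace (GA W)] in
/-- **The conjugation transport of the `T′`-type space**: a vector of weights `(−eP′, −eM′)` conjugates to a vector of
weights `(eP′, eM′)` (`hnorm`: unit modulus of the line weights on the local tori of `T′`), inside any `V′` that
contains the conjugate. -/
theorem mem_kTypeSpace'_conj (hnorm : ∀ (w : InfinitePlace k) (κ : GA W), κ ∈ localTorusAt' W w →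
      ∀ j : Fin 2, ‖weightAt' W q w g g' j κ‖ = 1)
    {V V' : Submodule ℂ (GA W → ℂ)} {ψ : GA W → ℂ} (hψ : ψ ∈ kTypeSpace' W q g g' (-eP') (-eM') K V)
    (hV' : (fun x => conj (ψ x)) ∈ V') : (fun x => conj (ψ x)) ∈ kTypeSpace' W q g g' eP' eM' K V' := by
  obtain ⟨-, hT', hK⟩ := (mem_kTypeSpace' W q g g' (-eP') (-eM') K V ψ).1 hψ
  refine (mem_kTypeSpace' W q g g' eP' eM' K V' _).2 ⟨hV', fun w x κ hκ => ?_, fun x κ hκ => ?_⟩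
  · have h := hT' w x κ hκ
    simp only [Pi.neg_apply] at h
    rw [h, map_mul, map_mul, conj_zpow_neg_of_norm_one (hnorm w κ hκ 0), conj_zpow_neg_of_norm_one (hnorm w κ hκ 1)]
  · rw [hK x κ hκ]

end ConjTransport

section Discharge

variable {k : Type} [Field k] [NumberField k] (W : PlaneData k) [MeasurableSpace (GA W)] [BorelSpace (GA W)]
  (q : QuadData k) (g g' : Matrix (Fin 4) (Fin 4) k) (eP' eM' : InfinitePlace k → ℤ)
  (ν : ∀ w : InfinitePlace k, Measure (localTorusAt' W w)) (K : Subgroup (GA W)) (νK : Measure K)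
  (R : RTFData W) (μ : Measure (GA W)) [μ.IsHaarMeasure] [R.μT.IsHaarMeasure] [R.μT'.IsHaarMeasure]
  (DG : Set (GA W)) (fdG : IsFundamentalDomain (rationalPoints W) DG μ) (compG : IsCompact (closure DG))
  (compT : IsCompact (closure R.DT)) (compT' : IsCompact (closure R.DT'))

/-- The span of a constituent of an adapted ONB is an invariant subspace of the setting. -/
theorem isInvariantSubspace_span_constituent {τ : ℕ → Set (GA W → ℂ)} {φ : ℕ → GA W → ℂ} {n : ℕ → ℕ}
    (hB : (Setting.ofAdelicData W R μ DG fdG compG compT compT').IsAdaptedONB τ φ n) (m : ℕ) (j : ℕ)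
    (hj : n j = m) :
    (Setting.ofAdelicData W R μ DG fdG compG compT compT').IsInvariantSubspace
      (Submodule.span ℂ (τ m) : Set (GA W → ℂ)) := by
  have hne : (τ m).Nonempty := ⟨φ j, hj ▸ hB.mem j⟩
  rw [coe_span_eq_of_isInvariantSubspace _ (hB.inv m) hne]
  exact hB.inv m

/-- **B-L4-CONJ, `hst₁`**: for `f₁ := projTest_{(−eP′, −eM′)} f`, every adapted ONB and every `j`,
`conj ∘ R(cj f₁)(φ j) ∈ kTypeSpace' W q g g' eP' eM' K (V (n j))` whenever `V (n j) ⊇ conj '' τ (n j)`. -/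
theorem hst₁_projTest_neg_of_le
    (hgood : ∀ d ∈ projData W q g g' (-eP') (-eM') ν K νK, d.Good)
    (hcomm : (projData W q g g' (-eP') (-eM') ν K νK).Pairwise ProjDatum.Commutes)
    (hnorm : ∀ (w : InfinitePlace k) (κ : GA W), κ ∈ localTorusAt' W w →
      ∀ j : Fin 2, ‖weightAt' W q w g g' j κ‖ = 1)
    {τ : ℕ → Set (GA W → ℂ)} {φ : ℕ → GA W → ℂ} {n : ℕ → ℕ}
    (hB : (Setting.ofAdelicData W R μ DG fdG compG compT compT').IsAdaptedONB τ φ n)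
    (V : ℕ → Submodule ℂ (GA W → ℂ))
    (hV : ∀ m, (fun ψ : GA W → ℂ => fun x => conj (ψ x)) '' τ m ⊆ (V m : Set (GA W → ℂ)))
    {f : GA W → ℂ} (hf : IsTestFn W f) (j : ℕ) :
    (fun x => conj (rightRegular W μ (RTF.cj (projTest W q g g' (-eP') (-eM') ν K νK f)) (φ j) x)) ∈
      kTypeSpace' W q g g' eP' eM' K (V (n j)) := by
  set S := Setting.ofAdelicData W R μ DG fdG compG compT compT' with hS
  have hVspan : S.IsInvariantSubspace (Submodule.span ℂ (τ (n j)) : Set (GA W → ℂ)) :=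
    isInvariantSubspace_span_constituent W R μ DG fdG compG compT compT' hB (n j) j rfl
  have hdirect := rightRegular_cj_projTest_mem W q g g' (-eP') (-eM') ν K νK R μ DG fdG compG compT compT' hgood
    hcomm hVspan hf (Submodule.subset_span (hB.mem j))
  refine mem_kTypeSpace'_conj W q g g' eP' eM' K hnorm hdirect ?_
  apply hV (n j)
  refine ⟨rightRegular W μ (RTF.cj (projTest W q g g' (-eP') (-eM') ν K νK f)) (φ j), ?_, rfl⟩
  have ht : RTF.IsTest (projTest W q g g' (-eP') (-eM') ν K νK f) :=
    ⟨(isTestFn_projTest W q g g' (-eP') (-eM') ν K νK hgood hf).1,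
      (isTestFn_projTest W q g g' (-eP') (-eM') ν K νK hgood hf).2⟩
  exact (hB.inv (n j)).conv (φ j) (hB.mem j) _ ht.cj

/-- **B-L4-CONJ, `hst₂`**: the same for `f₂ := projTest_{(−eP′, −eM′)} f'` and `refl f₂`. -/
theorem hst₂_projTest_neg_of_le
    (hgood : ∀ d ∈ projData W q g g' (-eP') (-eM') ν K νK, d.Good)
    (hcomm : (projData W q g g' (-eP') (-eM') ν K νK).Pairwise ProjDatum.Commutes)
    (hnorm : ∀ (w : InfinitePlace k) (κ : GA W), κ ∈ localTorusAt' W w →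
      ∀ j : Fin 2, ‖weightAt' W q w g g' j κ‖ = 1)
    {τ : ℕ → Set (GA W → ℂ)} {φ : ℕ → GA W → ℂ} {n : ℕ → ℕ}
    (hB : (Setting.ofAdelicData W R μ DG fdG compG compT compT').IsAdaptedONB τ φ n)
    (V : ℕ → Submodule ℂ (GA W → ℂ))
    (hV : ∀ m, (fun ψ : GA W → ℂ => fun x => conj (ψ x)) '' τ m ⊆ (V m : Set (GA W → ℂ)))
    {f' : GA W → ℂ} (hf' : IsTestFn W f') (j : ℕ) :
    (fun x => conj (rightRegular W μ (RTF.refl (projTest W q g g' (-eP') (-eM') ν K νK f')) (φ j) x)) ∈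
      kTypeSpace' W q g g' eP' eM' K (V (n j)) := by
  set S := Setting.ofAdelicData W R μ DG fdG compG compT compT' with hS
  have hVspan : S.IsInvariantSubspace (Submodule.span ℂ (τ (n j)) : Set (GA W → ℂ)) :=
    isInvariantSubspace_span_constituent W R μ DG fdG compG compT compT' hB (n j) j rfl
  have hdirect := rightRegular_refl_projTest_mem W q g g' (-eP') (-eM') ν K νK R μ DG fdG compG compT compT' hgood
    hcomm hVspan hf' (Submodule.subset_span (hB.mem j))
  refine mem_kTypeSpace'_conj W q g g' eP' eM' K hnorm hdirect ?_
  apply hV (n j)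
  refine ⟨rightRegular W μ (RTF.refl (projTest W q g g' (-eP') (-eM') ν K νK f')) (φ j), ?_, rfl⟩
  have ht : RTF.IsTest (projTest W q g g' (-eP') (-eM') ν K νK f') :=
    ⟨(isTestFn_projTest W q g g' (-eP') (-eM') ν K νK hgood hf').1,
      (isTestFn_projTest W q g g' (-eP') (-eM') ν K νK hgood hf').2⟩
  exact (hB.inv (n j)).conv (φ j) (hB.mem j) _ ht.refl

/-- **B-L4-CONJ on the planner's instance** `V m := span ℂ (conj '' τ m)`: `hst₁` verbatim. -/
theorem hst₁_projTest_neg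
    (hgood : ∀ d ∈ projData W q g g' (-eP') (-eM') ν K νK, d.Good)
    (hcomm : (projData W q g g' (-eP') (-eM') ν K νK).Pairwise ProjDatum.Commutes)
    (hnorm : ∀ (w : InfinitePlace k) (κ : GA W), κ ∈ localTorusAt' W w →
      ∀ j : Fin 2, ‖weightAt' W q w g g' j κ‖ = 1)
    {τ : ℕ → Set (GA W → ℂ)} {φ : ℕ → GA W → ℂ} {n : ℕ → ℕ}
    (hB : (Setting.ofAdelicData W R μ DG fdG compG compT compT').IsAdaptedONB τ φ n)
    {f : GA W → ℂ} (hf : IsTestFn W f) (j : ℕ) :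
    (fun x => conj (rightRegular W μ (RTF.cj (projTest W q g g' (-eP') (-eM') ν K νK f)) (φ j) x)) ∈
      kTypeSpace' W q g g' eP' eM' K
        (Submodule.span ℂ ((fun ψ : GA W → ℂ => fun x => conj (ψ x)) '' τ (n j))) :=
  hst₁_projTest_neg_of_le W q g g' eP' eM' ν K νK R μ DG fdG compG compT compT' hgood hcomm hnorm hB
    (fun m => Submodule.span ℂ ((fun ψ : GA W → ℂ => fun x => conj (ψ x)) '' τ m))
    (fun _ => Submodule.subset_span) hf j

/-- **B-L4-CONJ on the planner's instance**: `hst₂` verbatim. -/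
theorem hst₂_projTest_neg
    (hgood : ∀ d ∈ projData W q g g' (-eP') (-eM') ν K νK, d.Good)
    (hcomm : (projData W q g g' (-eP') (-eM') ν K νK).Pairwise ProjDatum.Commutes)
    (hnorm : ∀ (w : InfinitePlace k) (κ : GA W), κ ∈ localTorusAt' W w →
      ∀ j : Fin 2, ‖weightAt' W q w g g' j κ‖ = 1)
    {τ : ℕ → Set (GA W → ℂ)} {φ : ℕ → GA W → ℂ} {n : ℕ → ℕ}
    (hB : (Setting.ofAdelicData W R μ DG fdG compG compT compT').IsAdaptedONB τ φ n)
    {f' : GA W → ℂ} (hf' : IsTestFn W f') (j : ℕ) :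
    (fun x => conj (rightRegular W μ (RTF.refl (projTest W q g g' (-eP') (-eM') ν K νK f')) (φ j) x)) ∈
      kTypeSpace' W q g g' eP' eM' K
        (Submodule.span ℂ ((fun ψ : GA W → ℂ => fun x => conj (ψ x)) '' τ (n j))) :=
  hst₂_projTest_neg_of_le W q g g' eP' eM' ν K νK R μ DG fdG compG compT compT' hgood hcomm hnorm hB
    (fun m => Submodule.span ℂ ((fun ψ : GA W → ℂ => fun x => conj (ψ x)) '' τ m))
    (fun _ => Submodule.subset_span) hf' j

end Discharge

end Summit.Ventures.HodgeRepro.Tier4.Line4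

end
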